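import Literature.Analysis.FluidPDE.TaoAveragedCascade
import Literature.Analysis.FluidPDE.TaoCascadeODE
import Literature.Analysis.FunctionSpaces.LittlewoodPaleyProofs
import HarnessLib

/-!
# Tao's averaged Navier–Stokes blow-up: the cascade operator (4.1) is a symmetric local cascade operator with cancellation

T. Tao, *Finite time blowup for an averaged three-dimensional Navier–Stokes equation*,
J. Amer. Math. Soc. **29** (2016), 601–674 = arXiv:1402.0290v3 (held as `paper:arxiv-1402.0290`;
all numbers are those of that text), §4, p. 21: the wavelet data (balls `Bᵢ`, profiles `ψᵢ`),
the cascade operator (4.1), and the three sentences "From Definition 3.1 we see that `C` is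
indeed a local cascade operator (it is a sum of … basic local cascade operators), and (4.2)
ensures that `C` is symmetric. … the cancellation condition (3.2) will follow from the
cancellation conditions (4.3)".

This is the glue between the `L²` layer (`TaoAveragedSobolev.lean`, `TaoAveragedCascade.lean`:
`pairing`, `dil`, `schwartzL2`, `cascadeWavelet`, `basicCascadeForm`, `IsLocalCascadeForm`) and
the ODE layer (`TaoCascadeODE.lean`: structure constants `α : Fin m → Fin m → Fin m → ℤ × ℤ × ℤ → ℝ`,
`TaoCascade.shiftSet`, `IsSymmetricCoeff` (4.2), `IsCancellingCoeff` (4.3)) of the proof of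
Theorem 1.5. Everything here is a definition or is **proved**:

* `schwartzDil` — the dilation `Dil_c ψ = c^{3/2} ψ(c ·)` (1.11) on Schwartz profiles, with
  `schwartzL2_schwartzDil` (it is the accepted `dil` on `L²` classes), `cascadeWavelet_add_one`
  (`ψ_{n+1} = (Dil_{1+ε₀} ψ)_n`) and `fourier_complexify_schwartzDil`
  (`𝓕(Dil_c ψ)(ξ) = c^{3/2}|c|^{-3} 𝓕ψ(ξ/c)`, from the accepted `fourier_comp_smul`);
* `CascadeWaveletData` — Tao's data of §4 as a hypothesis structure, with the admissibility of
  the profiles and of their dilates for Definition 3.1 (`hasAnnularFourierSupport`,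
  `hasAnnularFourierSupport_dil`, `0 < ε₀ ≤ 1`);
* `cascadeOperatorForm` — the trilinear form of the cascade operator (4.1);
* `isLocalCascadeForm_cascadeOperatorForm` — (4.1) is a local cascade operator (Def. 3.1);
* `cascadeOperatorForm_symm` — (4.2) ⇒ `C` symmetric; `cascadeOperatorForm_cancel` — (4.3) ⇒
  `⟨C(u,u), u⟩ = 0`.

Lemma 4.1, the datum (4.4) and the deduction of Theorem 3.3 from Lemma 4.1 and Theorem 4.2 are in
the companion file `TaoCascadeMotion.lean`.

## Design notes

* All identities between forms in this file hold for **all** `u, v, w ∈ L²`, term by term: no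
  convergence of the series over `n` is used (inside a `tsum` only `tsum_congr` is applied), so no
  `tsum` junk value matters.
* `cascadeOperatorForm` puts the finite sum over `(i₁,i₂,i₃,μ)` outside the series over `n`
  (Tao writes `∑ₙ ∑_{(i,μ)}`); for `u, v, w ∈ H¹⁰_df` every series converges absolutely (Tao p. 14)
  and the two orders agree.
* The existence of wavelet data (any `m`, any `ε₀ > 0`) is routine but is **not** constructed
  here; `CascadeWaveletData.empty` only records that the structure is consistent (`m = 0`).

## References

* T. Tao, J. Amer. Math. Soc. 29 (2016), 601–674, arXiv:1402.0290v3, §4 p. 21 ((4.1)–(4.4)),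
  §3 Def. 3.1, (1.11). Key `Tao2016AveragedNS`.
-/

noncomputable section

open MeasureTheory Set Filter FourierTransform
open scoped ENNReal NNReal SchwartzMap

namespace Literature.Analysis.FluidPDE.Tao2016

/-- Local notation for physical / frequency space `ℝ³`. -/
local notation "ℝ³" => EuclideanSpace ℝ (Fin 3)
/-- Local notation for the complexified range `ℂ³`. -/
local notation "ℂ³" => EuclideanSpace ℂ (Fin 3)

/-! ### Dilations of Schwartz profiles and of the wavelets -/

/-- The `L²`-normalised **dilation of a Schwartz profile**, `(Dil_c ψ)(x) = c^{3/2} ψ(c x)`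
(Tao 2016, (1.11)) for a unit `c` (used with `c = 1 + ε₀ > 0`), as a Schwartz map: Mathlib's
`SchwartzMap.compCLMOfContinuousLinearEquiv` with `ContinuousLinearEquiv.smulLeft c`, times
`c^{3/2}`. [cite: Tao2016AveragedNS, (1.11)] -/
def schwartzDil (c : ℝˣ) (ψ : 𝓢(ℝ³, ℝ³)) : 𝓢(ℝ³, ℝ³) :=
  ((c : ℝ) ^ ((3 : ℝ) / 2)) •
    SchwartzMap.compCLMOfContinuousLinearEquiv ℝ (ContinuousLinearEquiv.smulLeft c : ℝ³ ≃L[ℝ] ℝ³) ψ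

/-- `(Dil_c ψ)(x) = c^{3/2} ψ(c x)`. [cite: Tao2016AveragedNS, (1.11)] -/
@[simp]
theorem schwartzDil_apply (c : ℝˣ) (ψ : 𝓢(ℝ³, ℝ³)) (x : ℝ³) :
    schwartzDil c ψ x = ((c : ℝ) ^ ((3 : ℝ) / 2)) • ψ ((c : ℝ) • x) := rfl

/-- The `L²` class of a real Schwartz field is represented by its complexification. [folklore] -/
theorem coeFn_schwartzL2 (f : 𝓢(ℝ³, ℝ³)) :
    (schwartzL2 f : ℝ³ → ℂ³) =ᵐ[volume] (FunctionSpaces.EuclideanSpace.complexify ∘ ⇑f) :=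
  MemLp.coeFn_toLp _

/-- A representative of `Dil_c u`: `c^{3/2} u(c x)` (`c ≠ 0`). [cite: Tao2016AveragedNS, (1.11)] -/
theorem coeFn_dil {c : ℝ} (hc : c ≠ 0) (u : L2C) :
    (dil c u : ℝ³ → ℂ³) =ᵐ[volume] fun x => (((c ^ ((3 : ℝ) / 2) : ℝ)) : ℂ) • (u : ℝ³ → ℂ³) (c • x) := by
  unfold dil
  rw [dif_neg hc]
  filter_upwards [Lp.coeFn_smul (((c ^ ((3 : ℝ) / 2) : ℝ)) : ℂ) ((memLp_comp_smul hc u).toLp _),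
    MemLp.coeFn_toLp (memLp_comp_smul hc u)] with x h1 h2
  rw [h1, Pi.smul_apply, h2]

/-- **The Schwartz-level and the `L²`-level dilations agree**: the `L²` class of `Dil_c ψ` is
`Dil_c` of the `L²` class of `ψ`. [cite: Tao2016AveragedNS, (1.11)] -/
theorem schwartzL2_schwartzDil (c : ℝˣ) (ψ : 𝓢(ℝ³, ℝ³)) :
    schwartzL2 (schwartzDil c ψ) = dil c (schwartzL2 ψ) := by
  apply Lp.ext
  have hq : Measure.QuasiMeasurePreserving (fun x : ℝ³ => (c : ℝ) • x) volume volume :=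
    Measure.quasiMeasurePreserving_smul volume c.ne_zero
  filter_upwards [coeFn_schwartzL2 (schwartzDil c ψ), coeFn_dil c.ne_zero (schwartzL2 ψ),
    hq.ae_eq (coeFn_schwartzL2 ψ)] with x h1 h2 h3
  simp only [Function.comp_apply] at h3
  rw [h1, h2, Function.comp_apply, schwartzDil_apply, h3, LinearIsometry.map_smul,
    Complex.coe_smul]

/-- **Shifting the scale of a wavelet is dilating its profile**:
`ψ_{n+1} = (Dil_{1+ε₀} ψ)_n`, i.e. `(1+ε₀)^{3(n+1)/2} ψ((1+ε₀)^{n+1}x) = (1+ε₀)^{3n/2} (Dil_{1+ε₀}ψ)((1+ε₀)ⁿx)`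
(Tao 2016, p. 21: the operator (4.1) "is a sum of basic local cascade operators"). [cite: Tao2016AveragedNS, §4 (4.1)] -/
theorem cascadeWavelet_add_one {ε₀ : ℝ} (hε₀ : 0 < 1 + ε₀) (ψ : 𝓢(ℝ³, ℝ³)) (n : ℤ) :
    cascadeWavelet ε₀ ψ (n + 1) =
      cascadeWavelet ε₀ (schwartzDil (Units.mk0 (1 + ε₀) hε₀.ne') ψ) n := by
  unfold cascadeWavelet
  rw [schwartzL2_schwartzDil, Units.val_mk0]
  apply Lp.ext
  have hn : (1 + ε₀) ^ n ≠ 0 := zpow_ne_zero n hε₀.ne'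
  have hn1 : (1 + ε₀) ^ (n + 1) ≠ 0 := zpow_ne_zero (n + 1) hε₀.ne'
  have hq : Measure.QuasiMeasurePreserving (fun x : ℝ³ => (1 + ε₀) ^ n • x) volume volume :=
    Measure.quasiMeasurePreserving_smul volume hn
  filter_upwards [coeFn_dil hn1 (schwartzL2 ψ), coeFn_dil hn (dil (1 + ε₀) (schwartzL2 ψ)),
    hq.ae_eq (coeFn_dil hε₀.ne' (schwartzL2 ψ))] with x h1 h2 h3
  simp only [Function.comp_apply] at h3
  rw [h1, h2, h3, smul_smul,
    show (1 + ε₀) ^ (n + 1) = (1 + ε₀) ^ n * (1 + ε₀) from zpow_add_one₀ hε₀.ne' n,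
    Real.mul_rpow (zpow_nonneg hε₀.le n) hε₀.le, Complex.ofReal_mul,
    mul_comm ((1 + ε₀) ^ n) (1 + ε₀), mul_smul (1 + ε₀) ((1 + ε₀) ^ n) x]

/-- **Fourier transform of a dilated profile**:
`𝓕(Dil_c ψ)(ξ) = c^{3/2} |c|^{-3} 𝓕ψ(ξ/c)` (change of variables; accepted
`Literature.Analysis.FunctionSpaces.fourier_comp_smul`). [folklore] -/
theorem fourier_complexify_schwartzDil (c : ℝˣ) (ψ : 𝓢(ℝ³, ℝ³)) (ξ : ℝ³) :
    𝓕 (FunctionSpaces.EuclideanSpace.complexify ∘ ⇑(schwartzDil c ψ)) ξ =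
      (((c : ℝ) ^ ((3 : ℝ) / 2) : ℝ) : ℂ) •
        (|((c : ℝ) ^ 3)⁻¹| • 𝓕 (FunctionSpaces.EuclideanSpace.complexify ∘ ⇑ψ) ((c : ℝ)⁻¹ • ξ)) := by
  have h1 : (FunctionSpaces.EuclideanSpace.complexify ∘ ⇑(schwartzDil c ψ)) =
      (((c : ℝ) ^ ((3 : ℝ) / 2) : ℝ) : ℂ) •
        fun x => (FunctionSpaces.EuclideanSpace.complexify ∘ ⇑ψ) ((c : ℝ) • x) := by
    funext x
    simp only [Function.comp_apply, schwartzDil_apply, LinearIsometry.map_smul, Pi.smul_apply,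
      Complex.coe_smul]
  rw [h1]
  rw [show 𝓕 ((((c : ℝ) ^ ((3 : ℝ) / 2) : ℝ) : ℂ) •
      fun x => (FunctionSpaces.EuclideanSpace.complexify ∘ ⇑ψ) ((c : ℝ) • x)) =
      (((c : ℝ) ^ ((3 : ℝ) / 2) : ℝ) : ℂ) •
        𝓕 (fun x => (FunctionSpaces.EuclideanSpace.complexify ∘ ⇑ψ) ((c : ℝ) • x)) from
    VectorFourier.fourierIntegral_const_smul _ _ _ _ _]
  rw [Pi.smul_apply, FunctionSpaces.fourier_comp_smul _ c.ne_zero ξ, finrank_euclideanSpace,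
    Fintype.card_fin]

/-! ### Tao's wavelet data (§4, p. 21) -/

/-- **Tao's wavelet data for the cascade operator (4.1)** (2016, §4, p. 21): a dimension
parameter `m`; balls `B₁, …, B_m` (centres and radii) in the annulus
`{ξ : 1 < |ξ| ≤ 1 + ε₀/2}` such that the `2m` balls `B₁, …, B_m, -B₁, …, -B_m` are pairwise
disjoint; and Schwartz profiles `ψ₁, …, ψ_m : ℝ³ → ℝ³`, divergence free (`ψᵢ ∈ H¹⁰_df`), with
Fourier transform real-valued and supported on `Bᵢ ∪ -Bᵢ`, normalised by `‖ψᵢ‖_{L²} = 1`.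
A hypothesis structure (the data exist for every `0 < ε₀` and `m`; the construction — bump
functions on the Fourier side — is not carried out here). [cite: Tao2016AveragedNS, §4 p. 21] -/
structure CascadeWaveletData (ε₀ : ℝ) (m : ℕ) where
  /-- The centres of the balls `Bᵢ`. -/
  center : Fin m → ℝ³
  /-- The radii of the balls `Bᵢ`. -/
  radius : Fin m → ℝ
  /-- `Bᵢ ⊆ {1 < |ξ| ≤ 1 + ε₀/2}`. -/
  ball_subset : ∀ i, Metric.ball (center i) (radius i) ⊆ {ξ : ℝ³ | 1 < ‖ξ‖ ∧ ‖ξ‖ ≤ 1 + ε₀ / 2}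
  /-- The balls `Bᵢ`, `Bⱼ` (`i ≠ j`) are disjoint … -/
  disjoint : ∀ i j, i ≠ j → Disjoint (Metric.ball (center i) (radius i)) (Metric.ball (center j) (radius j))
  /-- … and every `Bᵢ` is disjoint from every `-Bⱼ`. -/
  disjoint_neg : ∀ i j, Disjoint (Metric.ball (center i) (radius i)) (-Metric.ball (center j) (radius j))
  /-- The profiles `ψᵢ`. -/
  ψ : Fin m → 𝓢(ℝ³, ℝ³)
  /-- `ψᵢ` is divergence free. -/
  isDivFree : ∀ i, VectorCalculus.IsDivFree ⇑(ψ i)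
  /-- `ψ̂ᵢ` is real-valued … -/
  fourier_im : ∀ i ξ k, (𝓕 (FunctionSpaces.EuclideanSpace.complexify ∘ ⇑(ψ i)) ξ k).im = 0
  /-- … and supported on `Bᵢ ∪ -Bᵢ`. -/
  fourier_support : ∀ i ξ, ξ ∉ Metric.ball (center i) (radius i) →
    -ξ ∉ Metric.ball (center i) (radius i) → 𝓕 (FunctionSpaces.EuclideanSpace.complexify ∘ ⇑(ψ i)) ξ = 0
  /-- `‖ψᵢ‖_{L²(ℝ³)} = 1`. -/
  norm_eq_one : ∀ i, ‖schwartzL2 (ψ i)‖ = 1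

namespace CascadeWaveletData

variable {ε₀ : ℝ} {m : ℕ} (𝒟 : CascadeWaveletData ε₀ m)

/-- The profiles have Fourier support in the annulus `{1-2ε₀ ≤ |ξ| ≤ 1+2ε₀}` of Definition 3.1
(`Bᵢ ∪ -Bᵢ ⊆ {1 < |ξ| ≤ 1+ε₀/2}`). [cite: Tao2016AveragedNS, §4 p. 21] -/
theorem hasAnnularFourierSupport (i : Fin m) : HasAnnularFourierSupport ε₀ (𝒟.ψ i) := by
  intro ξ hξ
  refine 𝒟.fourier_support i ξ (fun h => ?_) (fun h => ?_)
  · have h' := 𝒟.ball_subset i h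
    simp only [Set.mem_setOf_eq] at h'
    rcases hξ with hξ | hξ <;> linarith [h'.1, h'.2]
  · have h' := 𝒟.ball_subset i h
    simp only [Set.mem_setOf_eq, norm_neg] at h'
    rcases hξ with hξ | hξ <;> linarith [h'.1, h'.2]

/-- The dilated profiles `Dil_{1+ε₀} ψᵢ` (whose wavelets are the scale-shifted `ψ_{i,n+1}`) still
have Fourier support in the annulus of Definition 3.1: it lies in
`(1+ε₀)·(Bᵢ ∪ -Bᵢ) ⊆ {1+ε₀ < |ξ| ≤ (1+ε₀)(1+ε₀/2)} ⊆ {1-2ε₀ ≤ |ξ| ≤ 1+2ε₀}` for `0 < ε₀ ≤ 1`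
(Tao 2016, p. 21: (4.1) "is a sum of basic local cascade operators"). [cite: Tao2016AveragedNS, §4 p. 21] -/
theorem hasAnnularFourierSupport_dil (hε₀ : 0 < ε₀) (hε₀1 : ε₀ ≤ 1) (i : Fin m) :
    HasAnnularFourierSupport ε₀
      (schwartzDil (Units.mk0 (1 + ε₀) (by positivity : (0 : ℝ) < 1 + ε₀).ne') (𝒟.ψ i)) := by
  intro ξ hξ
  rw [fourier_complexify_schwartzDil, Units.val_mk0]
  have hl : (0 : ℝ) < 1 + ε₀ := by positivity
  have hnorm : ‖(1 + ε₀)⁻¹ • ξ‖ = (1 + ε₀)⁻¹ * ‖ξ‖ := by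
    rw [norm_smul, Real.norm_eq_abs, abs_of_pos (inv_pos.2 hl)]
  suffices h0 : 𝓕 (FunctionSpaces.EuclideanSpace.complexify ∘ ⇑(𝒟.ψ i)) ((1 + ε₀)⁻¹ • ξ) = 0 by
    rw [h0, smul_zero, smul_zero]
  refine 𝒟.fourier_support i _ (fun h => ?_) (fun h => ?_)
  · have h' := 𝒟.ball_subset i h
    simp only [Set.mem_setOf_eq, hnorm] at h'
    obtain ⟨h1, h2⟩ := h'
    rw [lt_inv_mul_iff₀ hl] at h1
    rw [inv_mul_le_iff₀ hl] at h2
    rcases hξ with hξ | hξ <;> nlinarith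
  · have h' := 𝒟.ball_subset i h
    simp only [Set.mem_setOf_eq, norm_neg, hnorm] at h'
    obtain ⟨h1, h2⟩ := h'
    rw [lt_inv_mul_iff₀ hl] at h1
    rw [inv_mul_le_iff₀ hl] at h2
    rcases hξ with hξ | hξ <;> nlinarith

end CascadeWaveletData

/-- **Consistency of the data structure** (`m = 0`: no balls, no profiles). The data for `m ≥ 1`
exist for every `ε₀ > 0` (bump functions on the Fourier side) but are not constructed in this
file. [folklore] -/
def CascadeWaveletData.empty (ε₀ : ℝ) : CascadeWaveletData ε₀ 0 where
  center := Fin.elim0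
  radius := Fin.elim0
  ball_subset i := i.elim0
  disjoint i := i.elim0
  disjoint_neg i := i.elim0
  ψ := Fin.elim0
  isDivFree i := i.elim0
  fourier_im i := i.elim0
  fourier_support i := i.elim0
  norm_eq_one i := i.elim0

/-! ### The cascade operator (4.1) -/

/-- The trilinear duality form `⟨C(u,v), w⟩` of **Tao's cascade operator (4.1)** (2016, p. 21)
with dyadic parameter `ε₀`, profiles `ψ₁, …, ψ_m` and structure constants `α`:
`⟨C(u,v), w⟩ = ∑_{(i₁,i₂,i₃,μ₁,μ₂,μ₃) ∈ {1,…,m}³ × S} α_{i₁,i₂,i₃,μ₁,μ₂,μ₃} ∑_{n ∈ ℤ} (1+ε₀)^{5n/2} ⟨u, ψ_{i₁,n+μ₁}⟩ ⟨v, ψ_{i₂,n+μ₂}⟩ ⟨w, ψ_{i₃,n+μ₃}⟩`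
(Tao writes the sum over `n` outermost; for `u, v, w ∈ H¹⁰_df` every series converges absolutely
and the order is immaterial — here the finite sum of the series, `tsum` junk `0` where a series
diverges). Structure constants in the format of the accepted `TaoCascade.quadTerm`
(`α : Fin m → Fin m → Fin m → ℤ × ℤ × ℤ → ℝ`, shifts in `TaoCascade.shiftSet`). [cite: Tao2016AveragedNS, §4 (4.1)] -/
def cascadeOperatorForm (ε₀ : ℝ) {m : ℕ} (ψ : Fin m → 𝓢(ℝ³, ℝ³))
    (α : Fin m → Fin m → Fin m → ℤ × ℤ × ℤ → ℝ) (u v w : L2C) : ℂ :=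
  ∑ i₁, ∑ i₂, ∑ i₃, ∑ μ ∈ TaoCascade.shiftSet, (α i₁ i₂ i₃ μ : ℂ) *
    ∑' n : ℤ, (((1 + ε₀) ^ ((5 : ℝ) * (n : ℝ) / 2) : ℝ) : ℂ) *
      (pairing u (cascadeWavelet ε₀ (ψ i₁) (n + μ.1)) *
        pairing v (cascadeWavelet ε₀ (ψ i₂) (n + μ.2.1)) *
          pairing w (cascadeWavelet ε₀ (ψ i₃) (n + μ.2.2)))

/-- Local cascade forms indexed by an arbitrary finite type: a finite sum, over any `Fintype`, of
real multiples of basic local cascade forms with admissible profiles is a local cascade form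
(Definition 3.1 asks for a `Fin k`-indexed combination; reindex along `Fintype.equivFin`). [cite: Tao2016AveragedNS, Def. 3.1] -/
theorem IsLocalCascadeForm.of_fintype {ε₀ : ℝ} {ι : Type*} [Fintype ι] (c : ι → ℝ)
    (φ : ι → Fin 3 → 𝓢(ℝ³, ℝ³)) (hφ : ∀ j i, HasAnnularFourierSupport ε₀ (φ j i))
    {T : L2C → L2C → L2C → ℂ}
    (hT : ∀ u v w, MemH10df u → MemH10df v → MemH10dfC w →
      T u v w = ∑ j, (c j : ℂ) * basicCascadeForm ε₀ (φ j 0) (φ j 1) (φ j 2) u v w) :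
    IsLocalCascadeForm ε₀ T := by
  refine ⟨Fintype.card ι, c ∘ (Fintype.equivFin ι).symm, φ ∘ (Fintype.equivFin ι).symm,
    fun j i => hφ _ i, fun u v w hu hv hw => ?_⟩
  rw [hT u v w hu hv hw]
  exact (Equiv.sum_comp (Fintype.equivFin ι).symm
    (fun j => (c j : ℂ) * basicCascadeForm ε₀ (φ j 0) (φ j 1) (φ j 2) u v w)).symm

/-- The four shifts of `S` as a `Fin 4`-indexed family. [cite: Tao2016AveragedNS, §4 after (4.1)] -/
def shiftVec : Fin 4 → ℤ × ℤ × ℤ :=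
  ![(0, 0, 0), (1, 0, 0), (0, 1, 0), (0, 0, 1)]

/-- A sum over `TaoCascade.shiftSet` is a sum over `Fin 4` along `shiftVec`. [folklore] -/
theorem sum_shiftSet_eq_sum_shiftVec {M : Type*} [AddCommMonoid M] (f : ℤ × ℤ × ℤ → M) :
    ∑ μ ∈ TaoCascade.shiftSet, f μ = ∑ k : Fin 4, f (shiftVec k) := by
  rw [TaoCascade.shiftSet, Finset.sum_insert (by decide), Finset.sum_insert (by decide),
    Finset.sum_insert (by decide), Finset.sum_singleton, Fin.sum_univ_four]
  simp only [shiftVec, Matrix.cons_val_zero, Matrix.cons_val_one, Matrix.cons_val]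
  abel

/-- The profile whose scale-`n` wavelet is `ψ_{n+k}`, for a shift component `k ∈ {0, 1}`:
`ψ` itself for `k = 0`, `Dil_{1+ε₀} ψ` for `k = 1`. [cite: Tao2016AveragedNS, §4 (4.1)] -/
def shiftProfile (c : ℝˣ) (k : ℤ) (ψ : 𝓢(ℝ³, ℝ³)) : 𝓢(ℝ³, ℝ³) :=
  if k = 1 then schwartzDil c ψ else ψ

/-- `ψ_{n+k} = (shiftProfile k ψ)_n` for the shift components occurring in `S`. [cite: Tao2016AveragedNS, §4 (4.1)] -/
theorem cascadeWavelet_add_shiftVec {ε₀ : ℝ} (hε₀ : 0 < 1 + ε₀) (ψ : 𝓢(ℝ³, ℝ³)) (n : ℤ)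
    (k : Fin 4) :
    cascadeWavelet ε₀ ψ (n + (shiftVec k).1) =
        cascadeWavelet ε₀ (shiftProfile (Units.mk0 (1 + ε₀) hε₀.ne') (shiftVec k).1 ψ) n ∧
      cascadeWavelet ε₀ ψ (n + (shiftVec k).2.1) =
        cascadeWavelet ε₀ (shiftProfile (Units.mk0 (1 + ε₀) hε₀.ne') (shiftVec k).2.1 ψ) n ∧
      cascadeWavelet ε₀ ψ (n + (shiftVec k).2.2) =
        cascadeWavelet ε₀ (shiftProfile (Units.mk0 (1 + ε₀) hε₀.ne') (shiftVec k).2.2 ψ) n := by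
  fin_cases k <;>
    simp [shiftVec, shiftProfile, cascadeWavelet_add_one hε₀]

/-- The admissibility of the shifted profiles. [cite: Tao2016AveragedNS, §4 p. 21] -/
theorem CascadeWaveletData.hasAnnularFourierSupport_shiftProfile {ε₀ : ℝ} {m : ℕ}
    (𝒟 : CascadeWaveletData ε₀ m) (hε₀ : 0 < ε₀) (hε₀1 : ε₀ ≤ 1) (k : ℤ) (i : Fin m) :
    HasAnnularFourierSupport ε₀
      (shiftProfile (Units.mk0 (1 + ε₀) (by positivity : (0 : ℝ) < 1 + ε₀).ne') k (𝒟.ψ i)) := by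
  unfold shiftProfile
  split_ifs
  · exact 𝒟.hasAnnularFourierSupport_dil hε₀ hε₀1 i
  · exact 𝒟.hasAnnularFourierSupport i

/-- **The cascade operator (4.1) is a local cascade operator** (Tao 2016, p. 21: "From
Definition 3.1 we see that `C` is indeed a local cascade operator (it is a sum of … basic local
cascade operators)"): each term `(i₁,i₂,i₃,μ)` of (4.1) is `α_{i₁,i₂,i₃,μ}` times the basic form
(3.1) with profiles `(Dil_{1+ε₀}^{μ₁} ψ_{i₁}, Dil_{1+ε₀}^{μ₂} ψ_{i₂}, Dil_{1+ε₀}^{μ₃} ψ_{i₃})`, all of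
which have Fourier support in the annulus of Definition 3.1 when `0 < ε₀ ≤ 1`. The identity holds
for all `u, v, w ∈ L²` (no convergence is needed: term by term). [cite: Tao2016AveragedNS, §4 p. 21] -/
theorem isLocalCascadeForm_cascadeOperatorForm {ε₀ : ℝ} (hε₀ : 0 < ε₀) (hε₀1 : ε₀ ≤ 1) {m : ℕ}
    (𝒟 : CascadeWaveletData ε₀ m) (α : Fin m → Fin m → Fin m → ℤ × ℤ × ℤ → ℝ) :
    IsLocalCascadeForm ε₀ (cascadeOperatorForm ε₀ 𝒟.ψ α) := by
  have hl : (0 : ℝ) < 1 + ε₀ := by positivity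
  refine IsLocalCascadeForm.of_fintype (ι := Fin m × Fin m × Fin m × Fin 4)
    (fun p => α p.1 p.2.1 p.2.2.1 (shiftVec p.2.2.2))
    (fun p => ![shiftProfile (Units.mk0 (1 + ε₀) hl.ne') (shiftVec p.2.2.2).1 (𝒟.ψ p.1),
      shiftProfile (Units.mk0 (1 + ε₀) hl.ne') (shiftVec p.2.2.2).2.1 (𝒟.ψ p.2.1),
      shiftProfile (Units.mk0 (1 + ε₀) hl.ne') (shiftVec p.2.2.2).2.2 (𝒟.ψ p.2.2.1)])
    (fun p i => ?_) (fun u v w _ _ _ => ?_)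
  · fin_cases i <;> exact 𝒟.hasAnnularFourierSupport_shiftProfile hε₀ hε₀1 _ _
  · unfold cascadeOperatorForm basicCascadeForm
    simp only [Fintype.sum_prod_type, sum_shiftSet_eq_sum_shiftVec]
    refine Finset.sum_congr rfl fun i₁ _ => Finset.sum_congr rfl fun i₂ _ =>
      Finset.sum_congr rfl fun i₃ _ => Finset.sum_congr rfl fun k _ => ?_
    congr 1
    refine tsum_congr fun n => ?_
    obtain ⟨h1, h2, h3⟩ := cascadeWavelet_add_shiftVec hl (𝒟.ψ i₁) n k
    obtain ⟨-, h2', -⟩ := cascadeWavelet_add_shiftVec hl (𝒟.ψ i₂) n k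
    obtain ⟨-, -, h3'⟩ := cascadeWavelet_add_shiftVec hl (𝒟.ψ i₃) n k
    simp only [Matrix.cons_val_zero, Matrix.cons_val_one, Matrix.cons_val, h1, h2', h3']

/-! ### Symmetry and cancellation of the cascade operator from (4.2) and (4.3) -/

/-- Relabelling the finite index set of (4.1) by the transposition of the first two slots
(`S` is invariant under permuting coordinates). [folklore] -/
theorem sum_slots_swap₁₂ {M : Type*} [AddCommMonoid M] {m : ℕ}
    (g : Fin m → Fin m → Fin m → ℤ × ℤ × ℤ → M) :
    ∑ i₁, ∑ i₂, ∑ i₃, ∑ μ ∈ TaoCascade.shiftSet, g i₁ i₂ i₃ μ =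
      ∑ i₁, ∑ i₂, ∑ i₃, ∑ μ ∈ TaoCascade.shiftSet, g i₂ i₁ i₃ (μ.2.1, μ.1, μ.2.2) := by
  conv_rhs => rw [Finset.sum_comm]
  refine Finset.sum_congr rfl fun i₁ _ => Finset.sum_congr rfl fun i₂ _ =>
    Finset.sum_congr rfl fun i₃ _ => ?_
  simp only [sum_shiftSet_eq_sum_shiftVec, Fin.sum_univ_four, shiftVec, Matrix.cons_val_zero,
    Matrix.cons_val_one, Matrix.cons_val]
  abel

/-- Relabelling the finite index set of (4.1) by the transposition of the last two slots. [folklore] -/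
theorem sum_slots_swap₂₃ {M : Type*} [AddCommMonoid M] {m : ℕ}
    (g : Fin m → Fin m → Fin m → ℤ × ℤ × ℤ → M) :
    ∑ i₁, ∑ i₂, ∑ i₃, ∑ μ ∈ TaoCascade.shiftSet, g i₁ i₂ i₃ μ =
      ∑ i₁, ∑ i₂, ∑ i₃, ∑ μ ∈ TaoCascade.shiftSet, g i₁ i₃ i₂ (μ.1, μ.2.2, μ.2.1) := by
  refine Finset.sum_congr rfl fun i₁ _ => ?_
  conv_rhs => rw [Finset.sum_comm]
  refine Finset.sum_congr rfl fun i₂ _ => Finset.sum_congr rfl fun i₃ _ => ?_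
  simp only [sum_shiftSet_eq_sum_shiftVec, Fin.sum_univ_four, shiftVec, Matrix.cons_val_zero,
    Matrix.cons_val_one, Matrix.cons_val]
  abel

/-- **The cascade operator (4.1) is symmetric** when the structure constants obey the symmetry
condition (4.2) (Tao 2016, p. 21: "(4.2) ensures that `C` is symmetric"):
`⟨C(u,v), w⟩ = ⟨C(v,u), w⟩` for all `u, v, w` (term by term, relabelling `(i₁,μ₁) ↔ (i₂,μ₂)`). [cite: Tao2016AveragedNS, §4 (4.2)] -/
theorem cascadeOperatorForm_symm (ε₀ : ℝ) {m : ℕ} (ψ : Fin m → 𝓢(ℝ³, ℝ³))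
    {α : Fin m → Fin m → Fin m → ℤ × ℤ × ℤ → ℝ} (hα : TaoCascade.IsSymmetricCoeff α)
    (u v w : L2C) :
    cascadeOperatorForm ε₀ ψ α u v w = cascadeOperatorForm ε₀ ψ α v u w := by
  unfold cascadeOperatorForm
  rw [sum_slots_swap₁₂ (fun i₁ i₂ i₃ μ => (α i₁ i₂ i₃ μ : ℂ) * ∑' n : ℤ,
    (((1 + ε₀) ^ ((5 : ℝ) * (n : ℝ) / 2) : ℝ) : ℂ) *
      (pairing v (cascadeWavelet ε₀ (ψ i₁) (n + μ.1)) *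
        pairing u (cascadeWavelet ε₀ (ψ i₂) (n + μ.2.1)) *
          pairing w (cascadeWavelet ε₀ (ψ i₃) (n + μ.2.2))))]
  refine Finset.sum_congr rfl fun i₁ _ => Finset.sum_congr rfl fun i₂ _ =>
    Finset.sum_congr rfl fun i₃ _ => Finset.sum_congr rfl fun μ hμ => ?_
  have h := hα i₁ i₂ i₃ μ.1 μ.2.1 μ.2.2 (by simpa only [Prod.mk.eta] using hμ)
  simp only [Prod.mk.eta] at h
  rw [← h]
  congr 1
  exact tsum_congr fun n => by ring

/-- **The cascade operator (4.1) obeys the cancellation property (3.2)** when the structure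
constants obey the cancellation condition (4.3) (Tao 2016, p. 21: "the cancellation condition
(3.2) will follow from the cancellation conditions (4.3)"): `⟨C(u,u), u⟩ = 0` for every `u`.
Proof as in the source: in `⟨C(u,u), u⟩ = ∑_{(i,μ)} α_{i,μ} T_{i,μ}` the series
`T_{i,μ} = ∑ₙ (1+ε₀)^{5n/2} ⟨u, ψ_{i₁,n+μ₁}⟩ ⟨u, ψ_{i₂,n+μ₂}⟩ ⟨u, ψ_{i₃,n+μ₃}⟩` is invariant under
permuting the three slots, so relabelling the finite sum by each of the six permutations and
adding gives `6 ⟨C(u,u), u⟩ = ∑_{(i,μ)} (∑_{perm} α_{perm(i,μ)}) T_{i,μ} = 0`. [cite: Tao2016AveragedNS, §4 (4.3)] -/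
theorem cascadeOperatorForm_cancel (ε₀ : ℝ) {m : ℕ} (ψ : Fin m → 𝓢(ℝ³, ℝ³))
    {α : Fin m → Fin m → Fin m → ℤ × ℤ × ℤ → ℝ} (hα : TaoCascade.IsCancellingCoeff α)
    (u : L2C) :
    cascadeOperatorForm ε₀ ψ α u u u = 0 := by
  -- the slot-symmetric series
  set T : Fin m → ℤ → Fin m → ℤ → Fin m → ℤ → ℂ := fun a x b y c z =>
    ∑' n : ℤ, (((1 + ε₀) ^ ((5 : ℝ) * (n : ℝ) / 2) : ℝ) : ℂ) *
      (pairing u (cascadeWavelet ε₀ (ψ a) (n + x)) * pairing u (cascadeWavelet ε₀ (ψ b) (n + y)) *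
        pairing u (cascadeWavelet ε₀ (ψ c) (n + z))) with hT
  have T₁₂ : ∀ a x b y c z, T b y a x c z = T a x b y c z := fun a x b y c z => by
    simp only [hT]
    exact tsum_congr fun n => by ring
  have T₂₃ : ∀ a x b y c z, T a x c z b y = T a x b y c z := fun a x b y c z => by
    simp only [hT]
    exact tsum_congr fun n => by ring
  -- the form as a finite sum of `α • T`
  set SF : (Fin m → Fin m → Fin m → ℤ × ℤ × ℤ → ℝ) → ℂ := fun β =>
    ∑ i₁, ∑ i₂, ∑ i₃, ∑ μ ∈ TaoCascade.shiftSet,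
      (β i₁ i₂ i₃ μ : ℂ) * T i₁ μ.1 i₂ μ.2.1 i₃ μ.2.2 with hSF
  have hform : cascadeOperatorForm ε₀ ψ α u u u = SF α := rfl
  -- the six relabellings
  have e₁₂ : ∀ β : Fin m → Fin m → Fin m → ℤ × ℤ × ℤ → ℝ,
      SF (fun i₁ i₂ i₃ μ => β i₂ i₁ i₃ (μ.2.1, μ.1, μ.2.2)) = SF β := fun β => by
    simp only [hSF]
    rw [sum_slots_swap₁₂ (fun i₁ i₂ i₃ μ => (β i₁ i₂ i₃ μ : ℂ) * T i₁ μ.1 i₂ μ.2.1 i₃ μ.2.2)]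
    refine Finset.sum_congr rfl fun i₁ _ => Finset.sum_congr rfl fun i₂ _ =>
      Finset.sum_congr rfl fun i₃ _ => Finset.sum_congr rfl fun μ _ => ?_
    rw [T₁₂]
  have e₂₃ : ∀ β : Fin m → Fin m → Fin m → ℤ × ℤ × ℤ → ℝ,
      SF (fun i₁ i₂ i₃ μ => β i₁ i₃ i₂ (μ.1, μ.2.2, μ.2.1)) = SF β := fun β => by
    simp only [hSF]
    rw [sum_slots_swap₂₃ (fun i₁ i₂ i₃ μ => (β i₁ i₂ i₃ μ : ℂ) * T i₁ μ.1 i₂ μ.2.1 i₃ μ.2.2)]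
    refine Finset.sum_congr rfl fun i₁ _ => Finset.sum_congr rfl fun i₂ _ =>
      Finset.sum_congr rfl fun i₃ _ => Finset.sum_congr rfl fun μ _ => ?_
    rw [T₂₃]
  -- `β₂ = α ∘ (12)`, `β₃ = α ∘ (23)`, `β₄ = α ∘ (123)`, `β₅ = α ∘ (132)`, `β₆ = α ∘ (13)`
  have h₂ : SF (fun i₁ i₂ i₃ μ => α i₂ i₁ i₃ (μ.2.1, μ.1, μ.2.2)) = SF α := e₁₂ α
  have h₃ : SF (fun i₁ i₂ i₃ μ => α i₁ i₃ i₂ (μ.1, μ.2.2, μ.2.1)) = SF α := e₂₃ α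
  have h₄ : SF (fun i₁ i₂ i₃ μ => α i₂ i₃ i₁ (μ.2.1, μ.2.2, μ.1)) = SF α := by
    rw [← h₃]
    exact e₁₂ (fun i₁ i₂ i₃ μ => α i₁ i₃ i₂ (μ.1, μ.2.2, μ.2.1))
  have h₅ : SF (fun i₁ i₂ i₃ μ => α i₃ i₁ i₂ (μ.2.2, μ.1, μ.2.1)) = SF α := by
    rw [← h₂]
    exact e₂₃ (fun i₁ i₂ i₃ μ => α i₂ i₁ i₃ (μ.2.1, μ.1, μ.2.2))
  have h₆ : SF (fun i₁ i₂ i₃ μ => α i₃ i₂ i₁ (μ.2.2, μ.2.1, μ.1)) = SF α := by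
    rw [← h₄]
    exact e₂₃ (fun i₁ i₂ i₃ μ => α i₂ i₃ i₁ (μ.2.1, μ.2.2, μ.1))
  -- add up
  have hsum : (6 : ℂ) * SF α =
      SF (fun i₁ i₂ i₃ μ => α i₁ i₂ i₃ μ + α i₁ i₃ i₂ (μ.1, μ.2.2, μ.2.1) +
        α i₂ i₁ i₃ (μ.2.1, μ.1, μ.2.2) + α i₂ i₃ i₁ (μ.2.1, μ.2.2, μ.1) +
        α i₃ i₁ i₂ (μ.2.2, μ.1, μ.2.1) + α i₃ i₂ i₁ (μ.2.2, μ.2.1, μ.1)) := by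
    have hexp : ∀ β₁ β₂ : Fin m → Fin m → Fin m → ℤ × ℤ × ℤ → ℝ,
        SF (fun i₁ i₂ i₃ μ => β₁ i₁ i₂ i₃ μ + β₂ i₁ i₂ i₃ μ) = SF β₁ + SF β₂ := fun β₁ β₂ => by
      simp only [hSF, Complex.ofReal_add, add_mul, Finset.sum_add_distrib]
    rw [hexp, hexp, hexp, hexp, hexp, h₂, h₃, h₄, h₅, h₆]
    ring
  have hzero : SF (fun i₁ i₂ i₃ μ => α i₁ i₂ i₃ μ + α i₁ i₃ i₂ (μ.1, μ.2.2, μ.2.1) +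
        α i₂ i₁ i₃ (μ.2.1, μ.1, μ.2.2) + α i₂ i₃ i₁ (μ.2.1, μ.2.2, μ.1) +
        α i₃ i₁ i₂ (μ.2.2, μ.1, μ.2.1) + α i₃ i₂ i₁ (μ.2.2, μ.2.1, μ.1)) = 0 := by
    simp only [hSF]
    refine Finset.sum_eq_zero fun i₁ _ => Finset.sum_eq_zero fun i₂ _ =>
      Finset.sum_eq_zero fun i₃ _ => Finset.sum_eq_zero fun μ hμ => ?_
    have h := hα i₁ i₂ i₃ μ.1 μ.2.1 μ.2.2 (by simpa using hμ)
    simp only [Prod.mk.eta] at h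
    rw [h, Complex.ofReal_zero, zero_mul]
  rw [hform]
  have h6 : (6 : ℂ) * SF α = 0 := hsum.trans hzero
  simpa using h6

end Literature.Analysis.FluidPDE.Tao2016
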